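import Summits.CriticalPhenomena.PercolationContinuityZ3.Theorems.PercNearOneGluingNoHeavyQuantLSCoreMMGIneqA
import Summits.CriticalPhenomena.PercolationContinuityZ3.Theorems.PercNearOneGluingNoHeavyQuantLSCoreLLGIneqA
import Summits.CriticalPhenomena.PercolationContinuityZ3.Theorems.PercNearOneGluingNoHeavyQuantLSCoreLLGIneqB
import Summits.CriticalPhenomena.PercolationContinuityZ3.Theorems.PercNearOneGluingNoHeavyQuantLSCoreLLGIneqC
import Summits.CriticalPhenomena.PercolationContinuityZ3.Theorems.PercNearOneGluingNoHeavyQuantLSCoreLLGIneqD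
import Summits.CriticalPhenomena.PercolationContinuityZ3.Theorems.PercNearOneGluingNoHeavyQuantLSCoreLLGIneqE
import Mathlib.Tactic.Linarith
import Mathlib.Tactic.FieldSimp
import Mathlib.Tactic.Ring
import HarnessLib

/-!
# QUANT lane R8, T-DEC, binder (II) `ConvClosedTResidue`: LS-CORE, pattern LLG — the breakpoint inequalities of the two-low greedy after
# pre-routing both row-`m` lows into the head cell (kG)

builds on p205010 (kernel theorem, internal audit signed; external expert review pending)

Support file (`--supports stmt-CriticalPhenomena-4575`), QUANT lane seat prim-quant-census-1 (gen 22), rung R8 of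
`run/shared/lean/prim/quant/LADDER.md`.  Theorems only, standard axioms, no sorries.  Memo `…/prim-quant-census-1/LSCORE-G22.md` §9–§10.

Pattern LLG (`2(m+l′) < T`): both light cells of row `m` are lows; `m+l′` (pair "4", deficit `r+d−2w`, span `1−w`, always light) and then
`m+l` (pair "3") are pre-routed into the head cell `p+h`, rests to the giant; the two row-`p` lows then see the head cell (residual capacity
`cPres`) and the residual pool.  Where a cell would be too large for a certificate the light pre-routing efficiency is replaced by its
lower bound `1/x − 1` (a light pair never costs more than the giant rate) — a monotone weakening proved inside the lemma.

[this work].  The gluing rows served [cite: KozmaNitzan2024, Conjecture 3 (p. 15)]; product measure [cite: Grimmett1999, §1.3 p. 10].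
-/

namespace Summit.CriticalPhenomena.PercolationContinuityZ3.Theorems

namespace Quant

namespace LawDec

namespace LSCoreLLG

/-- auxiliary step for `kG_LLG`: from `u·e₃ ≥ λ + λ′(1−x)e₃/(x·E₄)` (the inequality `W4`, multiplied out)
to `λ(1−x)E₄ + λ′(1−x)e₃ ≤ x·e₃·E₄`. [this work] -/
theorem aux_mu4 (Lm Lp x ee Ee : ℝ) (hsum : Lm + Lp = 1) (hE : 0 < Ee)
    (hW : 0 ≤ Lp * x * ee - Lm * ((1 - x) - x * ee) - Lp * (1 - x) * ee / Ee) :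
    Lm * (1 - x) * Ee + Lp * (1 - x) * ee ≤ x * ee * Ee := by
  have hc : Lp * (1 - x) * ee / Ee * Ee = Lp * (1 - x) * ee := div_mul_cancel₀ _ hE.ne'
  have hWE := mul_nonneg hW hE.le
  have h3 : Lm * (x * ee * Ee) + Lp * (x * ee * Ee) = x * ee * Ee := by rw [← add_mul, hsum, one_mul]
  nlinarith [hWE, hc, h3]

set_option maxHeartbeats 8000000 in
/-- `kG_LLG`, branch where pair 4 is filled at the residual head price (`hf4`). [this work] -/
theorem kG_LLG_f (x r t d w e2P e3 cP1 pool1 cPres poolres : ℝ) (hx0 : 0 < x) (hx1 : x < 1) (hr0 : 0 ≤ r) (hrx : r < x) (ht : 0 < t) (hw0 : 0 < w) (hw1 : w < 1)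
    (hd0 : 0 ≤ d) (hdx : d < x * w) (hre : 0 < r - x + t * (2 - x)) (hre1 : 0 < 1 - t - r)
    (hM2 : 2 * w < r + d)
    (h2P_N : 1 ≤ (r + d) → e2P = 0)
    (h2P_H : x ≤ (r + d) → (r + d) < 1 → e2P = (1 / (r + d) - 1))
    (h2P_L : (r + d) < x → e2P = (1 / ((1 - x) * (r + d) + x ^ (2:ℕ)) - 1))
    (h3_H : x * (1 + t - w) ≤ (r + d + 2 * t - 2 * w) → e3 = (((1 + t - w) - (r + d + 2 * t - 2 * w)) / (r + d + 2 * t - 2 * w)))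
    (h3_L : (r + d + 2 * t - 2 * w) < x * (1 + t - w) → e3 = (((1 + t - w) - ((1 - x) * (r + d + 2 * t - 2 * w) + x ^ (2:ℕ) * (1 + t - w))) / ((1 - x) * (r + d + 2 * t - 2 * w) + x ^ (2:ℕ) * (1 + t - w))))
    (hc4_f : ((x ^ (2:ℕ) + (1 - x) * d / w) * (1 - x) * ((1 + x - r) * (r - x + t * (2 - x)) / (t * (2 - x ^ (2:ℕ) - (1 - x) * r) - x * (x - r)))) ≤ ((1 - (x ^ (2:ℕ) + (1 - x) * d / w)) * x) * (((1 - w) - ((1 - x) * (r + d - 2 * w) + x ^ (2:ℕ) * (1 - w))) / ((1 - x) * (r + d - 2 * w) + x ^ (2:ℕ) * (1 - w))) → cP1 = ((1 - (x ^ (2:ℕ) + (1 - x) * d / w)) * x) - ((x ^ (2:ℕ) + (1 - x) * d / w) * (1 - x) * ((1 + x - r) * (r - x + t * (2 - x)) / (t * (2 - x ^ (2:ℕ) - (1 - x) * r) - x * (x - r)))) / (((1 - w) - ((1 - x) * (r + d - 2 * w) + x ^ (2:ℕ) * (1 - w))) / ((1 - x) * (r + d - 2 * w) + x ^ (2:ℕ)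 * (1 - w))) ∧ pool1 = ((x ^ (2:ℕ) + (1 - x) * d / w) * (1 - x)))
    (_hc4_s : ((1 - (x ^ (2:ℕ) + (1 - x) * d / w)) * x) * (((1 - w) - ((1 - x) * (r + d - 2 * w) + x ^ (2:ℕ) * (1 - w))) / ((1 - x) * (r + d - 2 * w) + x ^ (2:ℕ) * (1 - w))) < ((x ^ (2:ℕ) + (1 - x) * d / w) * (1 - x) * ((1 + x - r) * (r - x + t * (2 - x)) / (t * (2 - x ^ (2:ℕ) - (1 - x) * r) - x * (x - r)))) → cP1 = 0 ∧ pool1 = (((x ^ (2:ℕ) + (1 - x) * d / w) * (1 - x)) - ((x ^ (2:ℕ) + (1 - x) * d / w) * (1 - x) * ((1 + x - r) * (r - x + t * (2 - x)) / (t * (2 - x ^ (2:ℕ) - (1 - x) * r) - x * (x - r)))) + ((1 - (x ^ (2:ℕ) + (1 - x) * d / w)) * x) * (((1 - w) - ((1 - x) * (r + d - 2 * w) + x ^ (2:ℕ) * (1 - w))) / ((1 - x) * (r + d - 2 * w) + x ^ (2:ℕ) * (1 - w)))))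
    (hc3_f : ((x ^ (2:ℕ) + (1 - x) * d / w) * (1 - x) * ((x - r) * (1 - t - r) / (t * (2 - x ^ (2:ℕ) - (1 - x) * r) - x * (x - r)))) ≤ cP1 * e3 → cPres = cP1 - ((x ^ (2:ℕ) + (1 - x) * d / w) * (1 - x) * ((x - r) * (1 - t - r) / (t * (2 - x ^ (2:ℕ) - (1 - x) * r) - x * (x - r)))) / e3 ∧ poolres = pool1)
    (hc3_s : cP1 * e3 < ((x ^ (2:ℕ) + (1 - x) * d / w) * (1 - x) * ((x - r) * (1 - t - r) / (t * (2 - x ^ (2:ℕ) - (1 - x) * r) - x * (x - r)))) → cPres = 0 ∧ poolres = (pool1 - ((x ^ (2:ℕ) + (1 - x) * d / w) * (1 - x) * ((x - r) * (1 - t - r) / (t * (2 - x ^ (2:ℕ) - (1 - x) * r) - x * (x - r)))) + cP1 * e3))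
    (hpre : cPres * e2P ≤ ((1 - (x ^ (2:ℕ) + (1 - x) * d / w)) * (1 - x) * ((1 + x - r) * (r - x + t * (2 - x)) / (t * (2 - x ^ (2:ℕ) - (1 - x) * r) - x * (x - r)))))
    (hf4 : (((x ^ (2:ℕ) + (1 - x) * d / w) * (1 - x) * ((1 + x - r) * (r - x + t * (2 - x)) / (t * (2 - x ^ (2:ℕ) - (1 - x) * r) - x * (x - r))))) ≤ (((1 - (x ^ (2:ℕ) + (1 - x) * d / w)) * x) * (((1 - w) - ((1 - x) * (r + d - 2 * w) + x ^ (2:ℕ) * (1 - w))) / ((1 - x) * (r + d - 2 * w) + x ^ (2:ℕ) * (1 - w))))) :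
    ((1 - (x ^ (2:ℕ) + (1 - x) * d / w)) * (1 - x) * ((x - r) * (1 - t - r) / (t * (2 - x ^ (2:ℕ) - (1 - x) * r) - x * (x - r)))) + ((1 - (x ^ (2:ℕ) + (1 - x) * d / w)) * (1 - x) * ((1 + x - r) * (r - x + t * (2 - x)) / (t * (2 - x ^ (2:ℕ) - (1 - x) * r) - x * (x - r)))) ≤ cPres * e2P + poolres := by
  have hD : 0 < t * (2 - x ^ (2:ℕ) - (1 - x) * r) - x * (x - r) := LSCoreMMG.D_pos x r t hx0 hx1 hr0 hrx hre
  have hxw : x * w ≤ x := by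
    have h_ := mul_pos hx0 (sub_pos.2 hw1)
    linarith
  have hb4 : r + d - 2 * w < x * (1 - w) := by
    have h_ := mul_pos hw0 (sub_pos.2 hx1)
    linarith
  have hb4c : r + d - 2 * w < 1 - w := by
    have h_ := mul_pos (sub_pos.2 hw1) (sub_pos.2 hx1)
    linarith
  have hb3c : r + d + 2 * t - 2 * w < 1 + t - w := by
    have h_ := mul_pos hw0 (sub_pos.2 hx1)
    linarith
  have hg0 : 0 ≤ (x ^ (2:ℕ) + (1 - x) * d / w) := by positivity
  have hlam : 0 ≤ ((x - r) * (1 - t - r) / (t * (2 - x ^ (2:ℕ) - (1 - x) * r) - x * (x - r))) := div_nonneg (mul_nonneg (by linarith) (by linarith)) hD.le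
  have hlaml : 0 ≤ ((1 + x - r) * (r - x + t * (2 - x)) / (t * (2 - x ^ (2:ℕ) - (1 - x) * r) - x * (x - r))) := div_nonneg (mul_nonneg (by linarith) hre.le) hD.le
  have hcM1 : 0 ≤ ((x ^ (2:ℕ) + (1 - x) * d / w) * (1 - x) * ((x - r) * (1 - t - r) / (t * (2 - x ^ (2:ℕ) - (1 - x) * r) - x * (x - r)))) := mul_nonneg (mul_nonneg hg0 (by linarith)) hlam
  have hcM2 : 0 ≤ ((x ^ (2:ℕ) + (1 - x) * d / w) * (1 - x) * ((1 + x - r) * (r - x + t * (2 - x)) / (t * (2 - x ^ (2:ℕ) - (1 - x) * r) - x * (x - r)))) := mul_nonneg (mul_nonneg hg0 (by linarith)) hlaml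
  have hcM1pos : 0 < ((x ^ (2:ℕ) + (1 - x) * d / w) * (1 - x) * ((x - r) * (1 - t - r) / (t * (2 - x ^ (2:ℕ) - (1 - x) * r) - x * (x - r)))) := by
    apply mul_pos (mul_pos (by positivity) (by linarith))
    exact div_pos (mul_pos (by linarith) (by linarith)) hD
  have hG4 : 0 < ((1 - x) * (r + d - 2 * w) + x ^ (2:ℕ) * (1 - w)) := by
    have h_1 := mul_pos (sub_pos.2 hx1) (show (0:ℝ) < r + d - 2 * w by linarith)
    have h_2 := mul_pos (mul_pos hx0 hx0) (sub_pos.2 hw1)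
    linarith
  have he4num : 0 < (1 - w) - ((1 - x) * (r + d - 2 * w) + x ^ (2:ℕ) * (1 - w)) := by
    have h_1 := mul_pos (sub_pos.2 hx1) (show (0:ℝ) < (1 - w) * (1 + x) - (r + d - 2 * w) by have h_0 := mul_pos hx0 (sub_pos.2 hw1); linarith)
    linarith
  have he4pos : 0 < (((1 - w) - ((1 - x) * (r + d - 2 * w) + x ^ (2:ℕ) * (1 - w))) / ((1 - x) * (r + d - 2 * w) + x ^ (2:ℕ) * (1 - w))) := div_pos he4num hG4
  have h4w : ((1 - x) / x) ≤ (((1 - w) - ((1 - x) * (r + d - 2 * w) + x ^ (2:ℕ) * (1 - w))) / ((1 - x) * (r + d - 2 * w) + x ^ (2:ℕ) * (1 - w))) := by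
    have h1 : ((1 - x) * (r + d - 2 * w) + x ^ (2:ℕ) * (1 - w)) ≤ x * (1 - w) := by
      have h_1 := mul_nonneg (sub_pos.2 hx1).le (sub_nonneg.2 hb4.le)
      linarith
    rw [div_le_div_iff₀ hx0 hG4]; linarith [h1]
  have hsum : ((x - r) * (1 - t - r) / (t * (2 - x ^ (2:ℕ) - (1 - x) * r) - x * (x - r))) + ((1 + x - r) * (r - x + t * (2 - x)) / (t * (2 - x ^ (2:ℕ) - (1 - x) * r) - x * (x - r))) = 1 := by rw [← add_div, div_eq_one_iff_eq hD.ne']; ring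
  have hP : ((1 - (x ^ (2:ℕ) + (1 - x) * d / w)) * (1 - x) * ((x - r) * (1 - t - r) / (t * (2 - x ^ (2:ℕ) - (1 - x) * r) - x * (x - r)))) + ((1 - (x ^ (2:ℕ) + (1 - x) * d / w)) * (1 - x) * ((1 + x - r) * (r - x + t * (2 - x)) / (t * (2 - x ^ (2:ℕ) - (1 - x) * r) - x * (x - r)))) = (1 - (x ^ (2:ℕ) + (1 - x) * d / w)) * (1 - x) := by linear_combination (1 - (x ^ (2:ℕ) + (1 - x) * d / w)) * (1 - x) * hsum
  have hg1p : 0 ≤ 1 - (x ^ (2:ℕ) + (1 - x) * d / w) := by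
    have h4 : d / w ≤ x := by rw [div_le_iff₀ hw0]; linarith
    have h5 : (1 - x) * d / w ≤ (1 - x) * x := by rw [mul_div_assoc]; exact mul_le_mul_of_nonneg_left h4 (by linarith)
    linarith [h5]
  have hgl : ((x ^ (2:ℕ) + (1 - x) * d / w) * (1 - x) * ((x - r) * (1 - t - r) / (t * (2 - x ^ (2:ℕ) - (1 - x) * r) - x * (x - r)))) ≤ (x ^ (2:ℕ) + (1 - x) * d / w) * (1 - x) := mul_le_of_le_one_right (mul_nonneg hg0 (by linarith)) (by linarith [hsum, hlaml])
  have hgsum : (x ^ (2:ℕ) + (1 - x) * d / w) * (1 - x) * ((x - r) * (1 - t - r) / (t * (2 - x ^ (2:ℕ) - (1 - x) * r) - x * (x - r))) + (x ^ (2:ℕ) + (1 - x) * d / w) * (1 - x) * ((1 + x - r) * (r - x + t * (2 - x)) / (t * (2 - x ^ (2:ℕ) - (1 - x) * r) - x * (x - r))) = (x ^ (2:ℕ) + (1 - x) * d / w) * (1 - x) := by rw [← mul_add, hsum, mul_one]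
  have hcP0 : 0 ≤ ((1 - (x ^ (2:ℕ) + (1 - x) * d / w)) * x) := mul_nonneg hg1p hx0.le
  obtain ⟨hcP1, hpl1⟩ := hc4_f hf4
  rw [hcP1, hpl1] at hc3_f hc3_s
  rcases le_or_gt (((x ^ (2:ℕ) + (1 - x) * d / w) * (1 - x) * ((x - r) * (1 - t - r) / (t * (2 - x ^ (2:ℕ) - (1 - x) * r) - x * (x - r))))) ((((1 - (x ^ (2:ℕ) + (1 - x) * d / w)) * x) - ((x ^ (2:ℕ) + (1 - x) * d / w) * (1 - x) * ((1 + x - r) * (r - x + t * (2 - x)) / (t * (2 - x ^ (2:ℕ) - (1 - x) * r) - x * (x - r)))) / (((1 - w) - ((1 - x) * (r + d - 2 * w) + x ^ (2:ℕ) * (1 - w))) / ((1 - x) * (r + d - 2 * w) + x ^ (2:ℕ) * (1 - w)))) * e3) with hf3 | hs3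
  · obtain ⟨hcP, hpl⟩ := hc3_f hf3
    rw [hcP] at hpre ⊢
    rw [hpl]
    clear hc4_f _hc4_s hc3_f hc3_s
    rcases le_or_gt (x * (1 + t - w)) ((r + d + 2 * t - 2 * w)) with hk3 | hk3
    · rw [h3_H hk3] at *
      rcases lt_or_ge ((r + d)) 1 with h2av | h2n
      · rcases lt_or_ge ((r + d)) x with h2L | h2H
        · rw [h2P_L h2L] at hpre ⊢
          have hG : 0 < ((1 - x) * (r + d) + x ^ (2:ℕ)) := by positivity
          have hxG : ((1 - x) * (r + d) + x ^ (2:ℕ)) ≤ x := by linarith [mul_le_mul_of_nonneg_left h2L.le (sub_pos.2 hx1).le]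
          have he2 : (1 - x) / x ≤ (1 / ((1 - x) * (r + d) + x ^ (2:ℕ)) - 1) := by
            rw [div_le_iff₀ hx0]
            have h1x : 1 ≤ x / ((1 - x) * (r + d) + x ^ (2:ℕ)) := by rw [le_div_iff₀ hG]; linarith
            have : (1 / ((1 - x) * (r + d) + x ^ (2:ℕ)) - 1) * x = x / ((1 - x) * (r + d) + x ^ (2:ℕ)) - x := by ring
            linarith [this, h1x]
          have he3pos : 0 < (((1 + t - w) - (r + d + 2 * t - 2 * w)) / (r + d + 2 * t - 2 * w)) := div_pos (by linarith) (by linarith)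
          have hW4 := ineq_W4_3PH x r t d w hx0 hx1 hr0 hrx ht hw0 hw1 hd0 hdx hre hre1 hM2 hb4 hb4c hk3 hb3c
          set Ee : ℝ := (((1 - w) - ((1 - x) * (r + d - 2 * w) + x ^ (2:ℕ) * (1 - w))) / ((1 - x) * (r + d - 2 * w) + x ^ (2:ℕ) * (1 - w))) with hEe
          set ee : ℝ := (((1 + t - w) - (r + d + 2 * t - 2 * w)) / (r + d + 2 * t - 2 * w)) with hee
          set Lm : ℝ := ((x - r) * (1 - t - r) / (t * (2 - x ^ (2:ℕ) - (1 - x) * r) - x * (x - r))) with hLm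
          set Lp : ℝ := ((1 + x - r) * (r - x + t * (2 - x)) / (t * (2 - x ^ (2:ℕ) - (1 - x) * r) - x * (x - r))) with hLp
          set gg : ℝ := (x ^ (2:ℕ) + (1 - x) * d / w) with hgg
          clear_value Ee ee Lm Lp gg
          have hcP1 : 0 ≤ ((1 - gg) * x) - (gg * (1 - x) * Lp) / Ee := by have := (div_le_iff₀ he4pos).2 hf4; linarith
          have hμ4 : (1 - x) / (x * Ee) ≤ 1 := by
            rw [div_le_one (by positivity)]
            have := (div_le_iff₀ hx0).1 h4w
            linarith
          have e4' : ((gg * (1 - x) * Lp) / Ee) * ((1 - x) / x) = (gg * (1 - x) * Lp) * ((1 - x) / (x * Ee)) := by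
            rw [div_mul_div_comm, mul_comm Ee x, mul_div_assoc]
          have e1 : ((1 - gg) * x) * ((1 - x) / x) = (1 - gg) * (1 - x) := by field_simp
          have hs0 : 0 ≤ (((1 - gg) * x) - (gg * (1 - x) * Lp) / Ee - (gg * (1 - x) * Lm) / ee) := by have := (div_le_iff₀ he3pos).2 hf3; linarith
          have e2 : ((gg * (1 - x) * Lm) / ee) * ((1 - x) / x) = (gg * (1 - x) * Lm) * ((1 - x) / (x * ee)) := by
            rw [div_mul_div_comm, mul_comm ee x, mul_div_assoc]
          have hμ0' : Lm * (1 - x) * Ee + Lp * (1 - x) * ee ≤ x * ee * Ee := aux_mu4 Lm Lp x ee Ee hsum he4pos hW4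
          have hprod := mul_le_mul_of_nonneg_left hμ0' (mul_nonneg hx0.le (mul_nonneg hg0 (by linarith : (0:ℝ) ≤ 1 - x)))
          have hxe : (0:ℝ) < x * ee := by positivity
          have hxE : (0:ℝ) < x * Ee := by positivity
          have hμ' : ((gg * (1 - x) * Lm) * (1 - x)) / (x * ee) + ((gg * (1 - x) * Lp) * (1 - x)) / (x * Ee) ≤ gg * (1 - x) := by
            rw [div_add_div _ _ hxe.ne' hxE.ne', div_le_iff₀ (mul_pos hxe hxE)]
            linear_combination hprod
          have hμ : (gg * (1 - x) * Lm) * ((1 - x) / (x * ee)) + (gg * (1 - x) * Lp) * ((1 - x) / (x * Ee)) ≤ gg * (1 - x) := by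
            rw [← mul_div_assoc, ← mul_div_assoc]; exact hμ'
          have f1 : (((1 - gg) * x) - (gg * (1 - x) * Lp) / Ee - (gg * (1 - x) * Lm) / ee) * ((1 - x) / x) ≤ (((1 - gg) * x) - (gg * (1 - x) * Lp) / Ee - (gg * (1 - x) * Lm) / ee) * (1 / ((1 - x) * (r + d) + x ^ (2:ℕ)) - 1) := mul_le_mul_of_nonneg_left he2 hs0
          have f2 : (((1 - gg) * x) - (gg * (1 - x) * Lp) / Ee - (gg * (1 - x) * Lm) / ee) * ((1 - x) / x) = ((1 - gg) * x) * ((1 - x) / x) - ((gg * (1 - x) * Lp) / Ee) * ((1 - x) / x) - ((gg * (1 - x) * Lm) / ee) * ((1 - x) / x) := by ring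
          linarith [f1, f2, e1, e2, e4', hμ, hP]
        · rw [h2P_H h2H h2av] at hpre ⊢
          rcases le_or_gt (2 * (x ^ (2:ℕ) + (1 - x) * d / w)) 1 with hQ | hQ
          · have hc := ineq_kG_4PLf3PHf_HQp x r t d w hx0 hx1 hr0 hrx ht hw0 hw1 hd0 hdx hre hre1 hM2 hb4 hb4c hk3 hb3c hf4 hf3 h2H h2av (by simpa only [zero_mul, mul_zero, add_zero, zero_add] using hpre) hQ
            linarith
          · have hA0 : 0 < (r + d) := by linarith
            have he2p' : 0 ≤ (1 / (r + d) - 1) := by rw [sub_nonneg, le_div_iff₀ hA0]; linarith [h2av]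
            have he3pos : 0 < (((1 + t - w) - (r + d + 2 * t - 2 * w)) / (r + d + 2 * t - 2 * w)) := div_pos (by linarith) (by linarith)
            have hs0 : 0 ≤ ((1 - (x ^ (2:ℕ) + (1 - x) * d / w)) * x) - ((x ^ (2:ℕ) + (1 - x) * d / w) * (1 - x) * ((1 + x - r) * (r - x + t * (2 - x)) / (t * (2 - x ^ (2:ℕ) - (1 - x) * r) - x * (x - r)))) / (((1 - w) - ((1 - x) * (r + d - 2 * w) + x ^ (2:ℕ) * (1 - w))) / ((1 - x) * (r + d - 2 * w) + x ^ (2:ℕ) * (1 - w))) - ((x ^ (2:ℕ) + (1 - x) * d / w) * (1 - x) * ((x - r) * (1 - t - r) / (t * (2 - x ^ (2:ℕ) - (1 - x) * r) - x * (x - r)))) / (((1 + t - w) - (r + d + 2 * t - 2 * w)) / (r + d + 2 * t - 2 * w)) := by have := (div_le_iff₀ he3pos).2 hf3; linarith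
            have hq2 := mul_nonneg (show (0:ℝ) ≤ 2 * (x ^ (2:ℕ) + (1 - x) * d / w) - 1 by linarith) (show (0:ℝ) ≤ 1 - x by linarith)
            linarith [mul_nonneg hs0 he2p', hq2, hP]
      · rw [h2P_N h2n] at hpre ⊢
        have hc := ineq_kG_4PLf3PHf_N x r t d w hx0 hx1 hr0 hrx ht hw0 hw1 hd0 hdx hre hre1 hM2 hb4 hb4c hk3 hb3c hf4 hf3 h2n (by simpa only [zero_mul, mul_zero, add_zero, zero_add] using hpre)
        linarith

    · rw [h3_L hk3] at *
      rcases lt_or_ge ((r + d)) 1 with h2av | h2n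
      · rcases lt_or_ge ((r + d)) x with h2L | h2H
        · rw [h2P_L h2L] at hpre ⊢
          have hG : 0 < ((1 - x) * (r + d) + x ^ (2:ℕ)) := by positivity
          have hxG : ((1 - x) * (r + d) + x ^ (2:ℕ)) ≤ x := by linarith [mul_le_mul_of_nonneg_left h2L.le (sub_pos.2 hx1).le]
          have he2 : (1 - x) / x ≤ (1 / ((1 - x) * (r + d) + x ^ (2:ℕ)) - 1) := by
            rw [div_le_iff₀ hx0]
            have h1x : 1 ≤ x / ((1 - x) * (r + d) + x ^ (2:ℕ)) := by rw [le_div_iff₀ hG]; linarith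
            have : (1 / ((1 - x) * (r + d) + x ^ (2:ℕ)) - 1) * x = x / ((1 - x) * (r + d) + x ^ (2:ℕ)) - x := by ring
            linarith [this, h1x]
          have hG3pos : 0 < ((1 - x) * (r + d + 2 * t - 2 * w) + x ^ (2:ℕ) * (1 + t - w)) := add_pos_of_pos_of_nonneg (mul_pos (by linarith) (by linarith)) (mul_nonneg (sq_nonneg x) (by linarith))
          have he3pos : 0 < (((1 + t - w) - ((1 - x) * (r + d + 2 * t - 2 * w) + x ^ (2:ℕ) * (1 + t - w))) / ((1 - x) * (r + d + 2 * t - 2 * w) + x ^ (2:ℕ) * (1 + t - w))) := div_pos (by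
              have h_1 := mul_pos (sub_pos.2 hx1) (show (0:ℝ) < (1 + t - w) * (1 + x) - (r + d + 2 * t - 2 * w) by have h_0 := mul_pos hx0 (show (0:ℝ) < 1 + t - w by linarith); linarith)
              linarith) hG3pos
          have he3 : (1 - x) / x ≤ (((1 + t - w) - ((1 - x) * (r + d + 2 * t - 2 * w) + x ^ (2:ℕ) * (1 + t - w))) / ((1 - x) * (r + d + 2 * t - 2 * w) + x ^ (2:ℕ) * (1 + t - w))) := by
            rw [div_le_div_iff₀ hx0 hG3pos]; linarith [mul_le_mul_of_nonneg_left hk3.le (sub_pos.2 hx1).le]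
          set Ee : ℝ := (((1 - w) - ((1 - x) * (r + d - 2 * w) + x ^ (2:ℕ) * (1 - w))) / ((1 - x) * (r + d - 2 * w) + x ^ (2:ℕ) * (1 - w))) with hEe
          set ee : ℝ := (((1 + t - w) - ((1 - x) * (r + d + 2 * t - 2 * w) + x ^ (2:ℕ) * (1 + t - w))) / ((1 - x) * (r + d + 2 * t - 2 * w) + x ^ (2:ℕ) * (1 + t - w))) with hee
          set Lm : ℝ := ((x - r) * (1 - t - r) / (t * (2 - x ^ (2:ℕ) - (1 - x) * r) - x * (x - r))) with hLm
          set Lp : ℝ := ((1 + x - r) * (r - x + t * (2 - x)) / (t * (2 - x ^ (2:ℕ) - (1 - x) * r) - x * (x - r))) with hLp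
          set gg : ℝ := (x ^ (2:ℕ) + (1 - x) * d / w) with hgg
          clear_value Ee ee Lm Lp gg
          have hcP1 : 0 ≤ ((1 - gg) * x) - (gg * (1 - x) * Lp) / Ee := by have := (div_le_iff₀ he4pos).2 hf4; linarith
          have hμ4 : (1 - x) / (x * Ee) ≤ 1 := by
            rw [div_le_one (by positivity)]
            have := (div_le_iff₀ hx0).1 h4w
            linarith
          have e4' : ((gg * (1 - x) * Lp) / Ee) * ((1 - x) / x) = (gg * (1 - x) * Lp) * ((1 - x) / (x * Ee)) := by
            rw [div_mul_div_comm, mul_comm Ee x, mul_div_assoc]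
          have e1 : ((1 - gg) * x) * ((1 - x) / x) = (1 - gg) * (1 - x) := by field_simp
          have hs0 : 0 ≤ (((1 - gg) * x) - (gg * (1 - x) * Lp) / Ee - (gg * (1 - x) * Lm) / ee) := by have := (div_le_iff₀ he3pos).2 hf3; linarith
          have e2 : ((gg * (1 - x) * Lm) / ee) * ((1 - x) / x) = (gg * (1 - x) * Lm) * ((1 - x) / (x * ee)) := by
            rw [div_mul_div_comm, mul_comm ee x, mul_div_assoc]
          have hμ3 : (1 - x) / (x * ee) ≤ 1 := by
            rw [div_le_one (by positivity)]
            have := (div_le_iff₀ hx0).1 he3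
            linarith
          have hμ : (gg * (1 - x) * Lm) * ((1 - x) / (x * ee)) + (gg * (1 - x) * Lp) * ((1 - x) / (x * Ee)) ≤ gg * (1 - x) := by
            linarith [mul_le_of_le_one_right hcM1 hμ3, mul_le_of_le_one_right hcM2 hμ4, hgsum]
          have f1 : (((1 - gg) * x) - (gg * (1 - x) * Lp) / Ee - (gg * (1 - x) * Lm) / ee) * ((1 - x) / x) ≤ (((1 - gg) * x) - (gg * (1 - x) * Lp) / Ee - (gg * (1 - x) * Lm) / ee) * (1 / ((1 - x) * (r + d) + x ^ (2:ℕ)) - 1) := mul_le_mul_of_nonneg_left he2 hs0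
          have f2 : (((1 - gg) * x) - (gg * (1 - x) * Lp) / Ee - (gg * (1 - x) * Lm) / ee) * ((1 - x) / x) = ((1 - gg) * x) * ((1 - x) / x) - ((gg * (1 - x) * Lp) / Ee) * ((1 - x) / x) - ((gg * (1 - x) * Lm) / ee) * ((1 - x) / x) := by ring
          linarith [f1, f2, e1, e2, e4', hμ, hP]
        · rw [h2P_H h2H h2av] at hpre ⊢
          rcases le_or_gt (2 * (x ^ (2:ℕ) + (1 - x) * d / w)) 1 with hQ | hQ
          · have hc := ineq_kG_4PLf3PLf_HQp x r t d w hx0 hx1 hr0 hrx ht hw0 hw1 hd0 hdx hre hre1 hM2 hb4 hb4c hk3 hb3c hf4 hf3 h2H h2av (by simpa only [zero_mul, mul_zero, add_zero, zero_add] using hpre) hQ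
            linarith
          · have hA0 : 0 < (r + d) := by linarith
            have he2p' : 0 ≤ (1 / (r + d) - 1) := by rw [sub_nonneg, le_div_iff₀ hA0]; linarith [h2av]
            have hG3pos : 0 < ((1 - x) * (r + d + 2 * t - 2 * w) + x ^ (2:ℕ) * (1 + t - w)) := add_pos_of_pos_of_nonneg (mul_pos (by linarith) (by linarith)) (mul_nonneg (sq_nonneg x) (by linarith))
            have he3pos : 0 < (((1 + t - w) - ((1 - x) * (r + d + 2 * t - 2 * w) + x ^ (2:ℕ) * (1 + t - w))) / ((1 - x) * (r + d + 2 * t - 2 * w) + x ^ (2:ℕ) * (1 + t - w))) := div_pos (by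
                have h_1 := mul_pos (sub_pos.2 hx1) (show (0:ℝ) < (1 + t - w) * (1 + x) - (r + d + 2 * t - 2 * w) by have h_0 := mul_pos hx0 (show (0:ℝ) < 1 + t - w by linarith); linarith)
                linarith) hG3pos
            have he3 : (1 - x) / x ≤ (((1 + t - w) - ((1 - x) * (r + d + 2 * t - 2 * w) + x ^ (2:ℕ) * (1 + t - w))) / ((1 - x) * (r + d + 2 * t - 2 * w) + x ^ (2:ℕ) * (1 + t - w))) := by
              rw [div_le_div_iff₀ hx0 hG3pos]; linarith [mul_le_mul_of_nonneg_left hk3.le (sub_pos.2 hx1).le]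
            have hs0 : 0 ≤ ((1 - (x ^ (2:ℕ) + (1 - x) * d / w)) * x) - ((x ^ (2:ℕ) + (1 - x) * d / w) * (1 - x) * ((1 + x - r) * (r - x + t * (2 - x)) / (t * (2 - x ^ (2:ℕ) - (1 - x) * r) - x * (x - r)))) / (((1 - w) - ((1 - x) * (r + d - 2 * w) + x ^ (2:ℕ) * (1 - w))) / ((1 - x) * (r + d - 2 * w) + x ^ (2:ℕ) * (1 - w))) - ((x ^ (2:ℕ) + (1 - x) * d / w) * (1 - x) * ((x - r) * (1 - t - r) / (t * (2 - x ^ (2:ℕ) - (1 - x) * r) - x * (x - r)))) / (((1 + t - w) - ((1 - x) * (r + d + 2 * t - 2 * w) + x ^ (2:ℕ) * (1 + t - w))) / ((1 - x) * (r + d + 2 * t - 2 * w) + x ^ (2:ℕ) * (1 + t - w))) := by have := (div_le_iff₀ he3pos).2 hf3; linarith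
            have hq2 := mul_nonneg (show (0:ℝ) ≤ 2 * (x ^ (2:ℕ) + (1 - x) * d / w) - 1 by linarith) (show (0:ℝ) ≤ 1 - x by linarith)
            linarith [mul_nonneg hs0 he2p', hq2, hP]
      · rw [h2P_N h2n] at hpre ⊢
        have hc := ineq_kG_4PLf3PLf_N x r t d w hx0 hx1 hr0 hrx ht hw0 hw1 hd0 hdx hre hre1 hM2 hb4 hb4c hk3 hb3c hf4 hf3 h2n (by simpa only [zero_mul, mul_zero, add_zero, zero_add] using hpre)
        linarith

  · obtain ⟨hcP, hpl⟩ := hc3_s hs3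
    rw [hcP] at hpre ⊢
    rw [hpl]
    clear hc4_f _hc4_s hc3_f hc3_s
    rcases le_or_gt (x * (1 + t - w)) ((r + d + 2 * t - 2 * w)) with hk3 | hk3
    · rw [h3_H hk3] at *
      have he3pos : 0 < (((1 + t - w) - (r + d + 2 * t - 2 * w)) / (r + d + 2 * t - 2 * w)) := div_pos (by linarith) (by linarith)
      have hW4 := ineq_W4_3PH x r t d w hx0 hx1 hr0 hrx ht hw0 hw1 hd0 hdx hre hre1 hM2 hb4 hb4c hk3 hb3c
      set Ee : ℝ := (((1 - w) - ((1 - x) * (r + d - 2 * w) + x ^ (2:ℕ) * (1 - w))) / ((1 - x) * (r + d - 2 * w) + x ^ (2:ℕ) * (1 - w))) with hEe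
      set ee : ℝ := (((1 + t - w) - (r + d + 2 * t - 2 * w)) / (r + d + 2 * t - 2 * w)) with hee
      set Lm : ℝ := ((x - r) * (1 - t - r) / (t * (2 - x ^ (2:ℕ) - (1 - x) * r) - x * (x - r))) with hLm
      set Lp : ℝ := ((1 + x - r) * (r - x + t * (2 - x)) / (t * (2 - x ^ (2:ℕ) - (1 - x) * r) - x * (x - r))) with hLp
      set gg : ℝ := (x ^ (2:ℕ) + (1 - x) * d / w) with hgg
      clear_value Ee ee Lm Lp gg
      have hcP1 : 0 ≤ ((1 - gg) * x) - (gg * (1 - x) * Lp) / Ee := by have := (div_le_iff₀ he4pos).2 hf4; linarith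
      have hμ4 : (1 - x) / (x * Ee) ≤ 1 := by
        rw [div_le_one (by positivity)]
        have := (div_le_iff₀ hx0).1 h4w
        linarith
      have e4' : ((gg * (1 - x) * Lp) / Ee) * ((1 - x) / x) = (gg * (1 - x) * Lp) * ((1 - x) / (x * Ee)) := by
        rw [div_mul_div_comm, mul_comm Ee x, mul_div_assoc]
      have e1 : ((1 - gg) * x) * ((1 - x) / x) = (1 - gg) * (1 - x) := by field_simp
      by_cases hq : (1 - x) - x * ee ≤ 0
      · have he3' : (1 - x) / x ≤ ee := by rw [div_le_iff₀ hx0]; linarith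
        have f1 : (((1 - gg) * x) - (gg * (1 - x) * Lp) / Ee) * ((1 - x) / x) ≤ (((1 - gg) * x) - (gg * (1 - x) * Lp) / Ee) * ee := mul_le_mul_of_nonneg_left he3' hcP1
        have f2 : (((1 - gg) * x) - (gg * (1 - x) * Lp) / Ee) * ((1 - x) / x) = ((1 - gg) * x) * ((1 - x) / x) - ((gg * (1 - x) * Lp) / Ee) * ((1 - x) / x) := by ring
        linarith [f1, f2, e1, e4', mul_le_of_le_one_right hcM2 hμ4, hgsum, hgl, hP]
      · have hq' : 0 < (1 - x) - x * ee := not_le.1 hq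
        have hsat' : 0 < (gg * (1 - x) * Lm) - (((1 - gg) * x) - (gg * (1 - x) * Lp) / Ee) * ee := by linarith [hs3]
        have key : ((0 * e2P + ((gg * (1 - x)) - (gg * (1 - x) * Lm) + (((1 - gg) * x) - (gg * (1 - x) * Lp) / Ee) * ee)) - (((1 - gg) * (1 - x) * Lm) + ((1 - gg) * (1 - x) * Lp))) * (x * ee) - (gg * (1 - x)) * (Lp * x * ee - Lm * ((1 - x) - x * ee) - Lp * (1 - x) * ee / Ee) - ((1 - x) - x * ee) * ((gg * (1 - x) * Lm) - (((1 - gg) * x) - (gg * (1 - x) * Lp) / Ee) * ee) = ee * x * (x - 1) * (Lm + Lp - 1) := by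
          field_simp
          ring
        have hz : Lm + Lp - 1 = 0 := by linarith [hsum]
        rw [hz, mul_zero] at key
        have hFs : 0 ≤ ((0 * e2P + ((gg * (1 - x)) - (gg * (1 - x) * Lm) + (((1 - gg) * x) - (gg * (1 - x) * Lp) / Ee) * ee)) - (((1 - gg) * (1 - x) * Lm) + ((1 - gg) * (1 - x) * Lp))) * (x * ee) := by linarith [key, mul_nonneg (mul_nonneg hg0 (by linarith : (0:ℝ) ≤ 1 - x)) hW4, mul_nonneg hq'.le hsat'.le]
        have hpos : 0 < x * ee := by positivity
        have hF : 0 ≤ ((0 * e2P + ((gg * (1 - x)) - (gg * (1 - x) * Lm) + (((1 - gg) * x) - (gg * (1 - x) * Lp) / Ee) * ee)) - (((1 - gg) * (1 - x) * Lm) + ((1 - gg) * (1 - x) * Lp))) := by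
          by_contra hn
          push Not at hn
          linarith [mul_neg_of_neg_of_pos hn hpos]
        linarith

    · rw [h3_L hk3] at *
      have hG3pos : 0 < ((1 - x) * (r + d + 2 * t - 2 * w) + x ^ (2:ℕ) * (1 + t - w)) := add_pos_of_pos_of_nonneg (mul_pos (by linarith) (by linarith)) (mul_nonneg (sq_nonneg x) (by linarith))
      have he3pos : 0 < (((1 + t - w) - ((1 - x) * (r + d + 2 * t - 2 * w) + x ^ (2:ℕ) * (1 + t - w))) / ((1 - x) * (r + d + 2 * t - 2 * w) + x ^ (2:ℕ) * (1 + t - w))) := div_pos (by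
          have h_1 := mul_pos (sub_pos.2 hx1) (show (0:ℝ) < (1 + t - w) * (1 + x) - (r + d + 2 * t - 2 * w) by have h_0 := mul_pos hx0 (show (0:ℝ) < 1 + t - w by linarith); linarith)
          linarith) hG3pos
      have he3 : (1 - x) / x ≤ (((1 + t - w) - ((1 - x) * (r + d + 2 * t - 2 * w) + x ^ (2:ℕ) * (1 + t - w))) / ((1 - x) * (r + d + 2 * t - 2 * w) + x ^ (2:ℕ) * (1 + t - w))) := by
        rw [div_le_div_iff₀ hx0 hG3pos]; linarith [mul_le_mul_of_nonneg_left hk3.le (sub_pos.2 hx1).le]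
      set Ee : ℝ := (((1 - w) - ((1 - x) * (r + d - 2 * w) + x ^ (2:ℕ) * (1 - w))) / ((1 - x) * (r + d - 2 * w) + x ^ (2:ℕ) * (1 - w))) with hEe
      set ee : ℝ := (((1 + t - w) - ((1 - x) * (r + d + 2 * t - 2 * w) + x ^ (2:ℕ) * (1 + t - w))) / ((1 - x) * (r + d + 2 * t - 2 * w) + x ^ (2:ℕ) * (1 + t - w))) with hee
      set Lm : ℝ := ((x - r) * (1 - t - r) / (t * (2 - x ^ (2:ℕ) - (1 - x) * r) - x * (x - r))) with hLm
      set Lp : ℝ := ((1 + x - r) * (r - x + t * (2 - x)) / (t * (2 - x ^ (2:ℕ) - (1 - x) * r) - x * (x - r))) with hLp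
      set gg : ℝ := (x ^ (2:ℕ) + (1 - x) * d / w) with hgg
      clear_value Ee ee Lm Lp gg
      have hcP1 : 0 ≤ ((1 - gg) * x) - (gg * (1 - x) * Lp) / Ee := by have := (div_le_iff₀ he4pos).2 hf4; linarith
      have hμ4 : (1 - x) / (x * Ee) ≤ 1 := by
        rw [div_le_one (by positivity)]
        have := (div_le_iff₀ hx0).1 h4w
        linarith
      have e4' : ((gg * (1 - x) * Lp) / Ee) * ((1 - x) / x) = (gg * (1 - x) * Lp) * ((1 - x) / (x * Ee)) := by
        rw [div_mul_div_comm, mul_comm Ee x, mul_div_assoc]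
      have e1 : ((1 - gg) * x) * ((1 - x) / x) = (1 - gg) * (1 - x) := by field_simp
      have f1 : (((1 - gg) * x) - (gg * (1 - x) * Lp) / Ee) * ((1 - x) / x) ≤ (((1 - gg) * x) - (gg * (1 - x) * Lp) / Ee) * ee := mul_le_mul_of_nonneg_left he3 hcP1
      have f2 : (((1 - gg) * x) - (gg * (1 - x) * Lp) / Ee) * ((1 - x) / x) = ((1 - gg) * x) * ((1 - x) / x) - ((gg * (1 - x) * Lp) / Ee) * ((1 - x) / x) := by ring
      linarith [f1, f2, e1, e4', mul_le_of_le_one_right hcM2 hμ4, hgsum, hgl, hP]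


end LSCoreLLG

end LawDec

end Quant

end Summit.CriticalPhenomena.PercolationContinuityZ3.Theorems
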